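import Literature.GroupTheory.CombinatorialGroupTheory.RandomSclFreeGroupProofs
import HarnessLib

/-!
# Random rigidity of scl (Calegari–Walker 2013): proofs, part 18 — counting tripod copies

D. Calegari, A. Walker, *Random rigidity in the free group*, Geom. Topol. 17 (2013)
[CalegariWalker2013], §4.2 (Lemma 4.4, Lemma 4.7): the number of copies of a tripod with a given
joint, and the number of joints, are counts of copies of fixed subwords of `v`, hence almost
constant by the equidistribution of subwords (Prop. 2.3).

Here `v` is given as a function `vg : ℕ → Fin k × Bool` (letters of `v` at the positions `< n`,
reduced: `vg (i+1) ≠ (vg i)⁻¹`), `h` is the prong length, and a *rigid tripod copy* is a triple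
of corners `(c₀, c₁, c₂)` in `[lo, hi]` (`lo = g + h + 3`, `hi = n − h − 1`) such that for each
prong `i` the outgoing side (the `h` letters from `c_{i+2}`) is the inverse of the incoming side
(the `h` letters before `cᵢ`) and the joint does not extend outward
(`vg (cᵢ − h − 1) ≠ (vg (c_{i+2} + h))⁻¹`, cf. the *maximal* joints of loc. cit. §4.2). For a site
`(a, b)` (incoming side ending at `a`, outgoing side starting at `b`) the admissible free corners
`c` are exactly the occurrences of `(2k−2)²` reduced words of length `2h + 2` (Lemma 4.4: the
letters adjacent to the copy avoid one value each), and the sites themselves are occurrences of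
words of length `h + 2`. This file proves the pattern identities; the resulting bounds on the
number of copies are in the sequel.

* **`card_letters_ne_ne`** — `2k − 2` letters avoid two given distinct letters.
* **`site_good_of_corners`** — at every site of a copy the corner letters are compatible
  (`vg a ≠ (vg (b−1))⁻¹`), by reducedness.
* **`sitePattern_reduced`** — the `(2h+2)`-patterns over a compatible site are reduced words.
* **`patCond_iff_window`** — the free corners over a site are exactly the occurrences of the
  patterns (with the two end letters avoiding the extension letters).
-/

namespace Literature.GroupTheory.CombinatorialGroupTheory

section TripodPatterns

open Finset

/-- `2k − 2` letters of `Fin k × Bool` avoid two given distinct letters. [folklore] -/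
theorem card_letters_ne_ne {k : ℕ} (u u' : Fin k × Bool) (hu : u ≠ u') :
    (Finset.univ.filter fun x : Fin k × Bool => x ≠ u ∧ x ≠ u').card = 2 * k - 2 := by
  classical
  have h : (Finset.univ.filter fun x : Fin k × Bool => x ≠ u ∧ x ≠ u') =
      Finset.univ \ {u, u'} := by
    ext x
    simp [not_or]
  rw [h, Finset.card_sdiff, Finset.inter_eq_left.mpr (Finset.subset_univ _), Finset.card_univ,
    Fintype.card_prod, Fintype.card_fin, Fintype.card_bool, Finset.card_pair hu]
  omega

/-- A letter and an inverse: `u = (w.1, !w.2)` iff `w = (u.1, !u.2)`. [folklore] -/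
theorem eq_inv_letter_comm {k : ℕ} (u w : Fin k × Bool) :
    u = (w.1, !w.2) ↔ w = (u.1, !u.2) := by
  obtain ⟨u1, u2⟩ := u
  obtain ⟨w1, w2⟩ := w
  simp only [Prod.mk.injEq]
  constructor
  · rintro ⟨rfl, rfl⟩; simp
  · rintro ⟨rfl, rfl⟩; simp

/-- **Compatibility of the corner letters at a site (CW Lemma 4.4).** If the outgoing side at `a`
is the inverse of the incoming side ending at `c`, and the outgoing side at `c` is the inverse of
the incoming side ending at `b` (two of the three window conditions of a tripod copy with
corners `a, c, b`), then `vg a ≠ (vg (b − 1))⁻¹`, by reducedness at `c`.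
[cite: CalegariWalker2013, Lemma 4.4] -/
theorem site_good_of_corners {k : ℕ} (vg : ℕ → Fin k × Bool) (n h : ℕ) (hh : 1 ≤ h)
    (hred : ∀ i, i + 1 < n → vg (i + 1) ≠ ((vg i).1, !(vg i).2))
    (a b c : ℕ) (hch : h ≤ c) (hcn : c < n) (hbh : h ≤ b)
    (hW1 : ∀ q, q < h → vg (a + (h - 1 - q)) = ((vg (c - h + q)).1, !(vg (c - h + q)).2))
    (hW2 : ∀ q, q < h → vg (c + (h - 1 - q)) = ((vg (b - h + q)).1, !(vg (b - h + q)).2)) :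
    vg a ≠ ((vg (b - 1)).1, !(vg (b - 1)).2) := by
  intro hG
  have h1 := hW1 (h - 1) (by omega)
  have h2 := hW2 (h - 1) (by omega)
  have e1 : a + (h - 1 - (h - 1)) = a := by omega
  have e2 : c - h + (h - 1) = c - 1 := by omega
  have e3 : c + (h - 1 - (h - 1)) = c := by omega
  have e4 : b - h + (h - 1) = b - 1 := by omega
  rw [e1, e2] at h1
  rw [e3, e4] at h2
  -- `vg (c-1) = vg (b-1)` and `vg c = (vg (b-1))⁻¹`
  have h3 : vg (c - 1) = vg (b - 1) := by
    rw [hG] at h1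
    have := (eq_inv_letter_comm _ _).mp h1
    rw [this]
    obtain ⟨x, y⟩ := vg (b - 1)
    simp
  have h4 := hred (c - 1) (by omega)
  have e5 : c - 1 + 1 = c := by omega
  rw [e5, h3] at h4
  exact h4 h2

/-- **The patterns over a compatible site are reduced words (CW Lemma 4.4).** For a site
`(a, b)` with `vg a ≠ (vg (b−1))⁻¹` and end letters `x ≠ vg (a+h−1)`, `y ≠ vg (b−h)`, the
`(2h+2)`-pattern `x · (vg[a, a+h))⁻¹ · (vg[b−h, b))⁻¹ · y` is reduced (given that `vg` is
reduced on the relevant range). [cite: CalegariWalker2013, Lemma 4.4] -/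
theorem sitePattern_reduced {k : ℕ} (vg : ℕ → Fin k × Bool) (n h : ℕ) (hh : 1 ≤ h)
    (hred : ∀ i, i + 1 < n → vg (i + 1) ≠ ((vg i).1, !(vg i).2))
    (a b : ℕ) (ha : 1 ≤ a) (han : a + h < n) (hb : h + 1 ≤ b) (hbn : b < n)
    (hG : vg a ≠ ((vg (b - 1)).1, !(vg (b - 1)).2))
    (x y : Fin k × Bool) (hx : x ≠ vg (a + h - 1)) (hy : y ≠ vg (b - h)) :
    let τ : ℕ → Fin k × Bool := fun i => if i = 0 then x
      else if i ≤ h then ((vg (a + h - i)).1, !(vg (a + h - i)).2)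
      else if i ≤ 2 * h then ((vg (b + h - i)).1, !(vg (b + h - i)).2) else y
    ∀ i, i + 1 < 2 * h + 2 → τ (i + 1) ≠ ((τ i).1, !(τ i).2) := by
  intro τ i hi
  have hi0 : i + 1 ≠ 0 := by omega
  simp only [τ]
  rw [if_neg hi0]
  rcases Nat.lt_or_ge i 1 with h0 | h0
  · -- `i = 0`: `x` followed by `(vg (a+h-1))⁻¹`
    have hi' : i = 0 := by omega
    subst hi'
    rw [if_pos (by omega : 0 + 1 ≤ h), if_pos rfl]
    have e : a + h - (0 + 1) = a + h - 1 := by omega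
    rw [e, Ne, eq_inv_letter_comm]
    intro heq
    apply hx
    rw [heq]
    obtain ⟨u, w⟩ := vg (a + h - 1)
    simp
  rw [if_neg (by omega : i ≠ 0)]
  rcases Nat.lt_or_ge (i + 1) (h + 1) with h1 | h1
  · -- inside the first half: reducedness of `vg` at `a + h - i`
    rw [if_pos (by omega : i + 1 ≤ h), if_pos (by omega : i ≤ h)]
    simp only [Bool.not_not, Prod.mk.eta]
    have hr := hred (a + h - (i + 1)) (by omega)
    have e : a + h - (i + 1) + 1 = a + h - i := by omega
    rw [e] at hr
    intro heq
    apply hr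
    exact heq.symm
  rcases Nat.lt_or_ge i (h + 1) with h2 | h2
  · -- the junction `i = h`: `(vg a)⁻¹` then `(vg (b-1))⁻¹`
    have hi' : i = h := by omega
    subst hi'
    rw [if_neg (by omega : ¬ i + 1 ≤ i), if_pos (by omega : i + 1 ≤ 2 * i), if_pos le_rfl]
    simp only [Bool.not_not, Prod.mk.eta]
    have e1 : b + i - (i + 1) = b - 1 := by omega
    have e2 : a + i - i = a := by omega
    rw [e1, e2]
    intro heq
    apply hG
    exact heq.symm
  rcases Nat.lt_or_ge (i + 1) (2 * h + 1) with h3 | h3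
  · -- inside the second half: reducedness of `vg` at `b + h - i`
    rw [if_neg (by omega : ¬ i + 1 ≤ h), if_pos (by omega : i + 1 ≤ 2 * h),
      if_neg (by omega : ¬ i ≤ h), if_pos (by omega : i ≤ 2 * h)]
    simp only [Bool.not_not, Prod.mk.eta]
    have hr := hred (b + h - (i + 1)) (by omega)
    have e : b + h - (i + 1) + 1 = b + h - i := by omega
    rw [e] at hr
    intro heq
    apply hr
    exact heq.symm
  · -- the end: `(vg (b-h))⁻¹` then `y`
    have hi' : i = 2 * h := by omega
    subst hi'
    rw [if_neg (by omega : ¬ 2 * h + 1 ≤ h), if_neg (by omega : ¬ 2 * h + 1 ≤ 2 * h),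
      if_neg (by omega : ¬ 2 * h ≤ h), if_pos le_rfl]
    simp only [Bool.not_not, Prod.mk.eta]
    have e : b + h - 2 * h = b - h := by omega
    rw [e]
    exact hy

/-- **Free corners over a site = occurrences of the patterns.** For a site `(a, b)` and a
candidate free corner `c` (all at distance `> h` from the ends), the four conditions
"outgoing side at `a` = inverse of incoming side ending at `c`", "outgoing side at `c` = inverse
of incoming side ending at `b`", and the two non-extension conditions, hold iff the
`2h+2` letters of `vg` from `c − h − 1` spell the pattern with end letters `x = vg (c−h−1)`,
`y = vg (c+h)`, where `x ≠ (vg (a+h))⁻¹` and `y ≠ (vg (b−h−1))⁻¹`.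
[cite: CalegariWalker2013, Lemma 4.4 and Lemma 4.7] -/
theorem patCond_iff_window {k : ℕ} (vg : ℕ → Fin k × Bool) (h : ℕ) (hh : 1 ≤ h)
    (a b c : ℕ) (ha : 1 ≤ a) (hb : h + 1 ≤ b) (hc : h + 1 ≤ c) (x y : Fin k × Bool) :
    let τ : ℕ → Fin k × Bool := fun i => if i = 0 then x
      else if i ≤ h then ((vg (a + h - i)).1, !(vg (a + h - i)).2)
      else if i ≤ 2 * h then ((vg (b + h - i)).1, !(vg (b + h - i)).2) else y
    ((∀ q, q < h → vg (a + (h - 1 - q)) = ((vg (c - h + q)).1, !(vg (c - h + q)).2)) ∧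
      (∀ q, q < h → vg (c + (h - 1 - q)) = ((vg (b - h + q)).1, !(vg (b - h + q)).2)) ∧
      vg (c - h - 1) ≠ ((vg (a + h)).1, !(vg (a + h)).2) ∧
      vg (b - h - 1) ≠ ((vg (c + h)).1, !(vg (c + h)).2) ∧
      vg (c - h - 1) = x ∧ vg (c + h) = y) ↔
    ((∀ i, i < 2 * h + 2 → vg (c - h - 1 + i) = τ i) ∧
      x ≠ ((vg (a + h)).1, !(vg (a + h)).2) ∧ y ≠ ((vg (b - h - 1)).1, !(vg (b - h - 1)).2)) := by
  intro τ
  constructor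
  · rintro ⟨hW1, hW2, hR1, hR2, hx, hy⟩
    refine ⟨?_, hx ▸ hR1, ?_⟩
    · intro i hi
      simp only [τ]
      rcases Nat.eq_zero_or_pos i with h0 | h0
      · subst h0
        rw [if_pos rfl, ← hx]
        congr 1
      rw [if_neg (by omega)]
      rcases Nat.lt_or_ge i (h + 1) with h1 | h1
      · rw [if_pos (by omega)]
        have e := hW1 (i - 1) (by omega)
        have e1 : a + (h - 1 - (i - 1)) = a + h - i := by omega
        have e2 : c - h + (i - 1) = c - h - 1 + i := by omega
        rw [e1, e2] at e
        rw [e]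
        obtain ⟨u, w⟩ := vg (c - h - 1 + i)
        simp
      rcases Nat.lt_or_ge i (2 * h + 1) with h2 | h2
      · rw [if_neg (by omega), if_pos (by omega)]
        have e := hW2 (2 * h - i) (by omega)
        have e1 : c + (h - 1 - (2 * h - i)) = c - h - 1 + i := by omega
        have e2 : b - h + (2 * h - i) = b + h - i := by omega
        rw [e1, e2] at e
        exact e
      · rw [if_neg (by omega), if_neg (by omega)]
        have e : i = 2 * h + 1 := by omega
        subst e
        have e1 : c - h - 1 + (2 * h + 1) = c + h := by omega
        rw [e1, hy]
    · intro heq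
      apply hR2
      rw [hy, heq]
      obtain ⟨u, w⟩ := vg (b - h - 1)
      simp
  · rintro ⟨hwin, hx, hy⟩
    have hx' : vg (c - h - 1) = x := by
      have e := hwin 0 (by omega)
      simp only [τ, if_pos rfl, add_zero] at e
      exact e
    have hy' : vg (c + h) = y := by
      have e := hwin (2 * h + 1) (by omega)
      simp only [τ] at e
      rw [if_neg (by omega), if_neg (by omega), if_neg (by omega)] at e
      have e1 : c - h - 1 + (2 * h + 1) = c + h := by omega
      rw [e1] at e
      exact e
    refine ⟨?_, ?_, hx' ▸ hx, ?_, hx', hy'⟩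
    · intro q hq
      have e := hwin (q + 1) (by omega)
      simp only [τ] at e
      rw [if_neg (by omega), if_pos (by omega)] at e
      have e1 : c - h - 1 + (q + 1) = c - h + q := by omega
      have e2 : a + h - (q + 1) = a + (h - 1 - q) := by omega
      rw [e1, e2] at e
      rw [e]
      obtain ⟨u, w⟩ := vg (a + (h - 1 - q))
      simp
    · intro q hq
      have e := hwin (2 * h - q) (by omega)
      simp only [τ] at e
      rw [if_neg (by omega), if_neg (by omega), if_pos (by omega)] at e
      have e1 : c - h - 1 + (2 * h - q) = c + (h - 1 - q) := by omega
      have e2 : b + h - (2 * h - q) = b - h + q := by omega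
      rw [e1, e2] at e
      exact e
    · intro heq
      apply hy
      rw [← hy', heq]
      obtain ⟨u, w⟩ := vg (b - h - 1)
      simp

/-- **Counting the free corners over a site.** For a compatible site `(a, b)` the number of
free corners `c ∈ [lo, hi]` equals the sum, over the `2k − 2` admissible first letters `x` and
the `2k − 2` admissible last letters `y`, of the number of occurrences (at the positions
`c − h − 1`, `c ∈ [lo, hi]`) of the `(2h+2)`-pattern with end letters `x, y`.
[cite: CalegariWalker2013, Lemma 4.4 and Lemma 4.7] -/
theorem card_patSet_eq_sum {k : ℕ} (vg : ℕ → Fin k × Bool) (n h : ℕ) (hh : 1 ≤ h)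
    (hred : ∀ i, i + 1 < n → vg (i + 1) ≠ ((vg i).1, !(vg i).2))
    (lo hi : ℕ) (hlo : h + 1 ≤ lo) (hhi : hi + h < n) (a b : ℕ) (ha : 1 ≤ a) (hb : h + 1 ≤ b) :
    ((Finset.Icc lo hi).filter fun c =>
        (∀ q, q < h → vg (a + (h - 1 - q)) = ((vg (c - h + q)).1, !(vg (c - h + q)).2)) ∧
        (∀ q, q < h → vg (c + (h - 1 - q)) = ((vg (b - h + q)).1, !(vg (b - h + q)).2)) ∧
        vg (c - h - 1) ≠ ((vg (a + h)).1, !(vg (a + h)).2) ∧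
        vg (b - h - 1) ≠ ((vg (c + h)).1, !(vg (c + h)).2)).card =
      ∑ x ∈ Finset.univ.filter fun x : Fin k × Bool =>
          x ≠ ((vg (a + h)).1, !(vg (a + h)).2) ∧ x ≠ vg (a + h - 1),
        ∑ y ∈ Finset.univ.filter fun y : Fin k × Bool =>
            y ≠ ((vg (b - h - 1)).1, !(vg (b - h - 1)).2) ∧ y ≠ vg (b - h),
          ((Finset.Icc lo hi).filter fun c => ∀ i, i < 2 * h + 2 → vg (c - h - 1 + i) =
            (if i = 0 then x else if i ≤ h then ((vg (a + h - i)).1, !(vg (a + h - i)).2)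
              else if i ≤ 2 * h then ((vg (b + h - i)).1, !(vg (b + h - i)).2) else y)).card := by
  classical
  -- notation
  set X := Finset.univ.filter fun x : Fin k × Bool =>
    x ≠ ((vg (a + h)).1, !(vg (a + h)).2) ∧ x ≠ vg (a + h - 1) with hX
  set Y := Finset.univ.filter fun y : Fin k × Bool =>
    y ≠ ((vg (b - h - 1)).1, !(vg (b - h - 1)).2) ∧ y ≠ vg (b - h) with hY
  let τ : Fin k × Bool → Fin k × Bool → ℕ → Fin k × Bool := fun x y i =>
    if i = 0 then x else if i ≤ h then ((vg (a + h - i)).1, !(vg (a + h - i)).2)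
      else if i ≤ 2 * h then ((vg (b + h - i)).1, !(vg (b + h - i)).2) else y
  set S : Fin k × Bool → Fin k × Bool → Finset ℕ := fun x y =>
    (Finset.Icc lo hi).filter fun c => ∀ i, i < 2 * h + 2 → vg (c - h - 1 + i) = τ x y i with hS
  show _ = ∑ x ∈ X, ∑ y ∈ Y, (S x y).card
  -- the end letters of an occurrence
  have hS0 : ∀ x y c, c ∈ S x y → vg (c - h - 1) = x := by
    intro x y c hc
    rw [hS, Finset.mem_filter] at hc
    have e := hc.2 0 (by omega)
    simp only [τ, if_pos rfl, add_zero] at e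
    exact e
  have hS1 : ∀ x y c, c ∈ S x y → vg (c + h) = y := by
    intro x y c hc
    rw [hS, Finset.mem_filter] at hc
    have e := hc.2 (2 * h + 1) (by omega)
    simp only [τ] at e
    rw [if_neg (by omega), if_neg (by omega), if_neg (by omega)] at e
    rw [Finset.mem_Icc] at hc
    have e1 : c - h - 1 + (2 * h + 1) = c + h := by omega
    rw [e1] at e
    exact e
  -- the set of free corners is the disjoint union of the occurrence sets
  have hunion : ((Finset.Icc lo hi).filter fun c =>
      (∀ q, q < h → vg (a + (h - 1 - q)) = ((vg (c - h + q)).1, !(vg (c - h + q)).2)) ∧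
      (∀ q, q < h → vg (c + (h - 1 - q)) = ((vg (b - h + q)).1, !(vg (b - h + q)).2)) ∧
      vg (c - h - 1) ≠ ((vg (a + h)).1, !(vg (a + h)).2) ∧
      vg (b - h - 1) ≠ ((vg (c + h)).1, !(vg (c + h)).2)) =
      X.biUnion fun x => Y.biUnion fun y => S x y := by
    ext c
    rw [Finset.mem_filter, Finset.mem_biUnion]
    constructor
    · rintro ⟨hc, hW1, hW2, hR1, hR2⟩
      rw [Finset.mem_Icc] at hc
      have key := (patCond_iff_window vg h hh a b c ha hb (by omega) (vg (c - h - 1))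
        (vg (c + h))).mp ⟨hW1, hW2, hR1, hR2, rfl, rfl⟩
      obtain ⟨hwin, hx, hy⟩ := key
      refine ⟨vg (c - h - 1), ?_, ?_⟩
      · rw [hX, Finset.mem_filter]
        refine ⟨Finset.mem_univ _, hx, ?_⟩
        -- `x ≠ vg (a+h-1)` by reducedness at `c - h`
        have e := hwin 1 (by omega)
        dsimp only at e
        rw [if_neg (by omega), if_pos (by omega)] at e
        have hr := hred (c - h - 1) (by omega)
        have e1 : c - h - 1 + 1 = c - h := by omega
        rw [e1] at hr e
        intro heq
        apply hr
        rw [e, heq]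
      · rw [Finset.mem_biUnion]
        refine ⟨vg (c + h), ?_, ?_⟩
        · rw [hY, Finset.mem_filter]
          refine ⟨Finset.mem_univ _, hy, ?_⟩
          -- `y ≠ vg (b-h)` by reducedness at `c + h`
          have e := hwin (2 * h) (by omega)
          dsimp only at e
          rw [if_neg (by omega), if_neg (by omega), if_pos le_rfl] at e
          have hr := hred (c + h - 1) (by omega)
          have e1 : c + h - 1 + 1 = c + h := by omega
          have e2 : c - h - 1 + 2 * h = c + h - 1 := by omega
          have e3 : b + h - 2 * h = b - h := by omega
          rw [e1] at hr
          rw [e2, e3] at e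
          intro heq
          apply hr
          rw [e, heq]
          obtain ⟨u, w⟩ := vg (b - h)
          simp
        · rw [hS, Finset.mem_filter, Finset.mem_Icc]
          exact ⟨hc, hwin⟩
    · rintro ⟨x, hx, hc⟩
      rw [Finset.mem_biUnion] at hc
      obtain ⟨y, hy, hc⟩ := hc
      rw [hS, Finset.mem_filter] at hc
      obtain ⟨hcI, hwin⟩ := hc
      rw [hX, Finset.mem_filter] at hx
      rw [hY, Finset.mem_filter] at hy
      rw [Finset.mem_Icc] at hcI
      have key := (patCond_iff_window vg h hh a b c ha hb (by omega) x y).mpr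
        ⟨hwin, hx.2.1, hy.2.1⟩
      obtain ⟨hW1, hW2, hR1, hR2, -, -⟩ := key
      exact ⟨Finset.mem_Icc.mpr hcI, hW1, hW2, hR1, hR2⟩
  rw [hunion, Finset.card_biUnion]
  · refine Finset.sum_congr rfl fun x _ => ?_
    rw [Finset.card_biUnion]
    intro y _ y' _ hne
    show Disjoint (S x y) (S x y')
    rw [Finset.disjoint_left]
    intro c hc hc'
    exact hne ((hS1 x y c hc).symm.trans (hS1 x y' c hc'))
  · intro x _ x' _ hne
    show Disjoint (Y.biUnion fun y => S x y) (Y.biUnion fun y => S x' y)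
    rw [Finset.disjoint_left]
    intro c hc hc'
    rw [Finset.mem_biUnion] at hc hc'
    obtain ⟨y, -, hc⟩ := hc
    obtain ⟨y', -, hc'⟩ := hc'
    exact hne ((hS0 x y c hc).symm.trans (hS0 x' y' c hc'))

/-- The admissible first letters over a site number `2k − 2`. [cite: CalegariWalker2013, Lemma 4.4] -/
theorem card_admissible_fst {k : ℕ} (vg : ℕ → Fin k × Bool) (n h : ℕ) (hh : 1 ≤ h)
    (hred : ∀ i, i + 1 < n → vg (i + 1) ≠ ((vg i).1, !(vg i).2)) (a : ℕ) (han : a + h < n) :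
    (Finset.univ.filter fun x : Fin k × Bool =>
        x ≠ ((vg (a + h)).1, !(vg (a + h)).2) ∧ x ≠ vg (a + h - 1)).card = 2 * k - 2 := by
  apply card_letters_ne_ne
  intro heq
  have hr := hred (a + h - 1) (by omega)
  have e : a + h - 1 + 1 = a + h := by omega
  rw [e] at hr
  apply hr
  rw [eq_inv_letter_comm, ← heq]

/-- The admissible last letters over a site number `2k − 2`. [cite: CalegariWalker2013, Lemma 4.4] -/
theorem card_admissible_snd {k : ℕ} (vg : ℕ → Fin k × Bool) (n h : ℕ)
    (hred : ∀ i, i + 1 < n → vg (i + 1) ≠ ((vg i).1, !(vg i).2)) (b : ℕ) (hb : h + 1 ≤ b)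
    (hbn : b - h < n) :
    (Finset.univ.filter fun y : Fin k × Bool =>
        y ≠ ((vg (b - h - 1)).1, !(vg (b - h - 1)).2) ∧ y ≠ vg (b - h)).card = 2 * k - 2 := by
  apply card_letters_ne_ne
  intro heq
  have hr := hred (b - h - 1) (by omega)
  have e : b - h - 1 + 1 = b - h := by omega
  rw [e] at hr
  exact hr heq.symm

/-! ### Sites with a given incoming end `a` -/

/-- **Sites over `a` = occurrences of `(h+2)`-patterns.** `(a, b)` is a good site (outgoing side
at `b` inverse to the incoming side ending at `a`, no outward extension, compatible corner
letters) with `vg (b−1) = x`, `vg (b+h) = y` iff the `h + 2` letters from `b − 1` spell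
`x · (vg[a−h, a))⁻¹ʳᵉᵛ · y` and `x ≠ (vg a)⁻¹`, `y ≠ (vg (a−h−1))⁻¹`.
[cite: CalegariWalker2013, §4.2] -/
theorem goodB_iff_window {k : ℕ} (vg : ℕ → Fin k × Bool) (h : ℕ) (hh : 1 ≤ h)
    (a b : ℕ) (ha : h ≤ a) (hb : 1 ≤ b) (x y : Fin k × Bool) :
    let ρ : ℕ → Fin k × Bool := fun j => if j = 0 then x
      else if j ≤ h then ((vg (a - j)).1, !(vg (a - j)).2) else y
    ((∀ q, q < h → vg (b + (h - 1 - q)) = ((vg (a - h + q)).1, !(vg (a - h + q)).2)) ∧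
      vg (a - h - 1) ≠ ((vg (b + h)).1, !(vg (b + h)).2) ∧
      vg a ≠ ((vg (b - 1)).1, !(vg (b - 1)).2) ∧
      vg (b - 1) = x ∧ vg (b + h) = y) ↔
    ((∀ j, j < h + 2 → vg (b - 1 + j) = ρ j) ∧
      x ≠ ((vg a).1, !(vg a).2) ∧ y ≠ ((vg (a - h - 1)).1, !(vg (a - h - 1)).2)) := by
  intro ρ
  constructor
  · rintro ⟨hW, hR, hG, hx, hy⟩
    refine ⟨?_, ?_, ?_⟩
    · intro j hj
      simp only [ρ]
      rcases Nat.eq_zero_or_pos j with h0 | h0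
      · subst h0; rw [if_pos rfl, add_zero, hx]
      rw [if_neg (by omega)]
      rcases Nat.lt_or_ge j (h + 1) with h1 | h1
      · rw [if_pos (by omega)]
        have e := hW (h - j) (by omega)
        have e1 : b + (h - 1 - (h - j)) = b - 1 + j := by omega
        have e2 : a - h + (h - j) = a - j := by omega
        rw [e1, e2] at e
        exact e
      · rw [if_neg (by omega)]
        have e : j = h + 1 := by omega
        subst e
        have e1 : b - 1 + (h + 1) = b + h := by omega
        rw [e1, hy]
    · rw [← hx]; intro heq; exact hG ((eq_inv_letter_comm _ _).mp heq)
    · rw [← hy]; intro heq; exact hR ((eq_inv_letter_comm _ _).mp heq)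
  · rintro ⟨hwin, hx, hy⟩
    have hx' : vg (b - 1) = x := by
      have e := hwin 0 (by omega)
      simp only [ρ, if_pos rfl, add_zero] at e
      exact e
    have hy' : vg (b + h) = y := by
      have e := hwin (h + 1) (by omega)
      simp only [ρ] at e
      rw [if_neg (by omega), if_neg (by omega)] at e
      have e1 : b - 1 + (h + 1) = b + h := by omega
      rw [e1] at e
      exact e
    refine ⟨?_, ?_, ?_, hx', hy'⟩
    · intro q hq
      have e := hwin (h - q) (by omega)
      simp only [ρ] at e
      rw [if_neg (by omega), if_pos (by omega)] at e
      have e1 : b - 1 + (h - q) = b + (h - 1 - q) := by omega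
      have e2 : a - (h - q) = a - h + q := by omega
      rw [e1, e2] at e
      exact e
    · intro heq; apply hy; rw [← hy']; exact (eq_inv_letter_comm _ _).mp heq
    · intro heq; apply hx; rw [← hx']; exact (eq_inv_letter_comm _ _).mp heq

/-- **Counting the sites with incoming end `a`.** The number of `b ∈ [lo, hi]` such that
`(a, b)` is a good site equals the sum over the admissible end letters of the number of
occurrences (at `b − 1`, `b ∈ [lo, hi]`) of the corresponding `(h+2)`-pattern.
[cite: CalegariWalker2013, §4.2 and Lemma 4.7] -/
theorem card_goodB_eq_sum {k : ℕ} (vg : ℕ → Fin k × Bool) (n h : ℕ) (hh : 1 ≤ h)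
    (hred : ∀ i, i + 1 < n → vg (i + 1) ≠ ((vg i).1, !(vg i).2))
    (lo hi : ℕ) (hlo : 1 ≤ lo) (hhi : hi + h < n) (a : ℕ) (ha : h ≤ a) :
    ((Finset.Icc lo hi).filter fun b =>
        (∀ q, q < h → vg (b + (h - 1 - q)) = ((vg (a - h + q)).1, !(vg (a - h + q)).2)) ∧
        vg (a - h - 1) ≠ ((vg (b + h)).1, !(vg (b + h)).2) ∧
        vg a ≠ ((vg (b - 1)).1, !(vg (b - 1)).2)).card =
      ∑ x ∈ Finset.univ.filter fun x : Fin k × Bool =>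
          x ≠ ((vg a).1, !(vg a).2) ∧ x ≠ vg (a - 1),
        ∑ y ∈ Finset.univ.filter fun y : Fin k × Bool =>
            y ≠ ((vg (a - h - 1)).1, !(vg (a - h - 1)).2) ∧ y ≠ vg (a - h),
          ((Finset.Icc lo hi).filter fun b => ∀ j, j < h + 2 → vg (b - 1 + j) =
            (if j = 0 then x else if j ≤ h then ((vg (a - j)).1, !(vg (a - j)).2) else y)).card := by
  classical
  set X := Finset.univ.filter fun x : Fin k × Bool =>
    x ≠ ((vg a).1, !(vg a).2) ∧ x ≠ vg (a - 1) with hX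
  set Y := Finset.univ.filter fun y : Fin k × Bool =>
    y ≠ ((vg (a - h - 1)).1, !(vg (a - h - 1)).2) ∧ y ≠ vg (a - h) with hY
  let ρ : Fin k × Bool → Fin k × Bool → ℕ → Fin k × Bool := fun x y j =>
    if j = 0 then x else if j ≤ h then ((vg (a - j)).1, !(vg (a - j)).2) else y
  set S : Fin k × Bool → Fin k × Bool → Finset ℕ := fun x y =>
    (Finset.Icc lo hi).filter fun b => ∀ j, j < h + 2 → vg (b - 1 + j) = ρ x y j with hS
  show _ = ∑ x ∈ X, ∑ y ∈ Y, (S x y).card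
  have hS0 : ∀ x y b, b ∈ S x y → vg (b - 1) = x := by
    intro x y b hb
    rw [hS, Finset.mem_filter] at hb
    have e := hb.2 0 (by omega)
    simp only [ρ, if_pos rfl, add_zero] at e
    exact e
  have hS1 : ∀ x y b, b ∈ S x y → vg (b + h) = y := by
    intro x y b hb
    rw [hS, Finset.mem_filter, Finset.mem_Icc] at hb
    have e := hb.2 (h + 1) (by omega)
    simp only [ρ] at e
    rw [if_neg (by omega), if_neg (by omega)] at e
    have e1 : b - 1 + (h + 1) = b + h := by omega
    rw [e1] at e
    exact e
  have hunion : ((Finset.Icc lo hi).filter fun b =>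
      (∀ q, q < h → vg (b + (h - 1 - q)) = ((vg (a - h + q)).1, !(vg (a - h + q)).2)) ∧
      vg (a - h - 1) ≠ ((vg (b + h)).1, !(vg (b + h)).2) ∧
      vg a ≠ ((vg (b - 1)).1, !(vg (b - 1)).2)) =
      X.biUnion fun x => Y.biUnion fun y => S x y := by
    ext b
    rw [Finset.mem_filter, Finset.mem_biUnion]
    constructor
    · rintro ⟨hb, hW, hR, hG⟩
      rw [Finset.mem_Icc] at hb
      obtain ⟨hwin, hx, hy⟩ := (goodB_iff_window vg h hh a b ha (by omega) (vg (b - 1))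
        (vg (b + h))).mp ⟨hW, hR, hG, rfl, rfl⟩
      refine ⟨vg (b - 1), ?_, ?_⟩
      · rw [hX, Finset.mem_filter]
        refine ⟨Finset.mem_univ _, hx, ?_⟩
        have e := hwin 1 (by omega)
        dsimp only at e
        rw [if_neg (by omega), if_pos (by omega)] at e
        have hr := hred (b - 1) (by omega)
        have e1 : b - 1 + 1 = b := by omega
        rw [e1] at hr e
        intro heq
        apply hr
        rw [e, heq]
      · rw [Finset.mem_biUnion]
        refine ⟨vg (b + h), ?_, ?_⟩
        · rw [hY, Finset.mem_filter]
          refine ⟨Finset.mem_univ _, hy, ?_⟩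
          have e := hwin h (by omega)
          dsimp only at e
          rw [if_neg (by omega), if_pos le_rfl] at e
          have hr := hred (b + h - 1) (by omega)
          have e1 : b + h - 1 + 1 = b + h := by omega
          have e2 : b - 1 + h = b + h - 1 := by omega
          rw [e1] at hr
          rw [e2] at e
          intro heq
          apply hr
          rw [e, heq]
          obtain ⟨u, w⟩ := vg (a - h)
          simp
        · rw [hS, Finset.mem_filter, Finset.mem_Icc]
          exact ⟨hb, hwin⟩
    · rintro ⟨x, hx, hb⟩
      rw [Finset.mem_biUnion] at hb
      obtain ⟨y, hy, hb⟩ := hb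
      rw [hS, Finset.mem_filter] at hb
      obtain ⟨hbI, hwin⟩ := hb
      rw [hX, Finset.mem_filter] at hx
      rw [hY, Finset.mem_filter] at hy
      rw [Finset.mem_Icc] at hbI
      obtain ⟨hW, hR, hG, -, -⟩ := (goodB_iff_window vg h hh a b ha (by omega) x y).mpr
        ⟨hwin, hx.2.1, hy.2.1⟩
      exact ⟨Finset.mem_Icc.mpr hbI, hW, hR, hG⟩
  rw [hunion, Finset.card_biUnion]
  · refine Finset.sum_congr rfl fun x _ => ?_
    rw [Finset.card_biUnion]
    intro y _ y' _ hne
    show Disjoint (S x y) (S x y')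
    rw [Finset.disjoint_left]
    intro b hb hb'
    exact hne ((hS1 x y b hb).symm.trans (hS1 x y' b hb'))
  · intro x _ x' _ hne
    show Disjoint (Y.biUnion fun y => S x y) (Y.biUnion fun y => S x' y)
    rw [Finset.disjoint_left]
    intro b hb hb'
    rw [Finset.mem_biUnion] at hb hb'
    obtain ⟨y, -, hb⟩ := hb
    obtain ⟨y', -, hb'⟩ := hb'
    exact hne ((hS0 x y b hb).symm.trans (hS0 x' y' b hb'))

/-- The `(h+2)`-patterns over `a` are reduced words. [cite: CalegariWalker2013, §4.2] -/
theorem goodBPattern_reduced {k : ℕ} (vg : ℕ → Fin k × Bool) (n h : ℕ) (hh : 1 ≤ h)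
    (hred : ∀ i, i + 1 < n → vg (i + 1) ≠ ((vg i).1, !(vg i).2))
    (a : ℕ) (ha : h + 1 ≤ a) (han : a < n)
    (x y : Fin k × Bool) (hx : x ≠ vg (a - 1)) (hy : y ≠ vg (a - h)) :
    let ρ : ℕ → Fin k × Bool := fun j => if j = 0 then x
      else if j ≤ h then ((vg (a - j)).1, !(vg (a - j)).2) else y
    ∀ j, j + 1 < h + 2 → ρ (j + 1) ≠ ((ρ j).1, !(ρ j).2) := by
  intro ρ j hj
  simp only [ρ]
  rw [if_neg (show j + 1 ≠ 0 by omega)]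
  rcases Nat.eq_zero_or_pos j with h0 | h0
  · subst h0
    rw [if_pos (show 0 + 1 ≤ h by omega), if_pos rfl]
    have e : a - (0 + 1) = a - 1 := by omega
    rw [e, Ne, eq_inv_letter_comm]
    intro heq
    apply hx
    rw [heq]
    obtain ⟨u, w⟩ := vg (a - 1)
    simp
  rw [if_neg (show j ≠ 0 by omega)]
  rcases Nat.lt_or_ge (j + 1) (h + 1) with h1 | h1
  · rw [if_pos (show j + 1 ≤ h by omega), if_pos (show j ≤ h by omega)]
    simp only [Bool.not_not, Prod.mk.eta]
    have hr := hred (a - (j + 1)) (by omega)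
    have e : a - (j + 1) + 1 = a - j := by omega
    rw [e] at hr
    intro heq
    exact hr heq.symm
  · have e : j = h := by omega
    subst e
    rw [if_neg (show ¬ j + 1 ≤ j by omega), if_pos le_rfl]
    simp only [Bool.not_not, Prod.mk.eta]
    exact hy

/-- The admissible letters before a site over `a` number `2k − 2`. [folklore] -/
theorem card_admissibleB_fst {k : ℕ} (vg : ℕ → Fin k × Bool) (n : ℕ)
    (hred : ∀ i, i + 1 < n → vg (i + 1) ≠ ((vg i).1, !(vg i).2)) (a : ℕ) (ha : 1 ≤ a)
    (han : a < n) :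
    (Finset.univ.filter fun x : Fin k × Bool =>
        x ≠ ((vg a).1, !(vg a).2) ∧ x ≠ vg (a - 1)).card = 2 * k - 2 := by
  apply card_letters_ne_ne
  intro heq
  have hr := hred (a - 1) (by omega)
  have e : a - 1 + 1 = a := by omega
  rw [e] at hr
  apply hr
  rw [eq_inv_letter_comm, ← heq]

/-- The admissible letters after a site over `a` number `2k − 2`. [folklore] -/
theorem card_admissibleB_snd {k : ℕ} (vg : ℕ → Fin k × Bool) (n h : ℕ)
    (hred : ∀ i, i + 1 < n → vg (i + 1) ≠ ((vg i).1, !(vg i).2)) (a : ℕ) (ha : h + 1 ≤ a)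
    (han : a - h < n) :
    (Finset.univ.filter fun y : Fin k × Bool =>
        y ≠ ((vg (a - h - 1)).1, !(vg (a - h - 1)).2) ∧ y ≠ vg (a - h)).card = 2 * k - 2 := by
  apply card_letters_ne_ne
  intro heq
  have hr := hred (a - h - 1) (by omega)
  have e : a - h - 1 + 1 = a - h := by omega
  rw [e] at hr
  exact hr heq.symm

/-! ### Sites with a given outgoing start `b` -/

/-- **Sites with outgoing start `b` = occurrences of `(h+2)`-patterns** (at `a − h − 1`).
[cite: CalegariWalker2013, §4.2] -/
theorem goodA_iff_window {k : ℕ} (vg : ℕ → Fin k × Bool) (h : ℕ) (hh : 1 ≤ h)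
    (a b : ℕ) (ha : h + 1 ≤ a) (hb : 1 ≤ b) (x y : Fin k × Bool) :
    let ρ : ℕ → Fin k × Bool := fun j => if j = 0 then x
      else if j ≤ h then ((vg (b + h - j)).1, !(vg (b + h - j)).2) else y
    ((∀ q, q < h → vg (b + (h - 1 - q)) = ((vg (a - h + q)).1, !(vg (a - h + q)).2)) ∧
      vg (a - h - 1) ≠ ((vg (b + h)).1, !(vg (b + h)).2) ∧
      vg a ≠ ((vg (b - 1)).1, !(vg (b - 1)).2) ∧
      vg (a - h - 1) = x ∧ vg a = y) ↔
    ((∀ j, j < h + 2 → vg (a - h - 1 + j) = ρ j) ∧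
      x ≠ ((vg (b + h)).1, !(vg (b + h)).2) ∧ y ≠ ((vg (b - 1)).1, !(vg (b - 1)).2)) := by
  intro ρ
  constructor
  · rintro ⟨hW, hR, hG, hx, hy⟩
    refine ⟨?_, hx ▸ hR, hy ▸ hG⟩
    intro j hj
    simp only [ρ]
    rcases Nat.eq_zero_or_pos j with h0 | h0
    · subst h0; rw [if_pos rfl, add_zero, hx]
    rw [if_neg (by omega)]
    rcases Nat.lt_or_ge j (h + 1) with h1 | h1
    · rw [if_pos (by omega)]
      have e := hW (j - 1) (by omega)
      have e1 : b + (h - 1 - (j - 1)) = b + h - j := by omega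
      have e2 : a - h + (j - 1) = a - h - 1 + j := by omega
      rw [e1, e2] at e
      rw [eq_inv_letter_comm] at e
      exact e
    · rw [if_neg (by omega)]
      have e : j = h + 1 := by omega
      subst e
      have e1 : a - h - 1 + (h + 1) = a := by omega
      rw [e1, hy]
  · rintro ⟨hwin, hx, hy⟩
    have hx' : vg (a - h - 1) = x := by
      have e := hwin 0 (by omega)
      simp only [ρ, if_pos rfl, add_zero] at e
      exact e
    have hy' : vg a = y := by
      have e := hwin (h + 1) (by omega)
      simp only [ρ] at e
      rw [if_neg (by omega), if_neg (by omega)] at e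
      have e1 : a - h - 1 + (h + 1) = a := by omega
      rw [e1] at e
      exact e
    refine ⟨?_, hx' ▸ hx, hy' ▸ hy, hx', hy'⟩
    intro q hq
    have e := hwin (q + 1) (by omega)
    simp only [ρ] at e
    rw [if_neg (by omega), if_pos (by omega)] at e
    have e1 : a - h - 1 + (q + 1) = a - h + q := by omega
    have e2 : b + h - (q + 1) = b + (h - 1 - q) := by omega
    rw [e1, e2] at e
    rw [eq_inv_letter_comm]
    exact e

/-- **Counting the sites with outgoing start `b`** (upper-bound form: the set of `a ∈ [lo, hi]`
with `(a, b)` a good site is contained in a disjoint union of occurrence sets of `(h+2)`-patterns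
over `(2k−2)²` pairs of end letters). [cite: CalegariWalker2013, §4.2 and Lemma 4.7] -/
theorem card_goodA_eq_sum {k : ℕ} (vg : ℕ → Fin k × Bool) (n h : ℕ) (hh : 1 ≤ h)
    (hred : ∀ i, i + 1 < n → vg (i + 1) ≠ ((vg i).1, !(vg i).2))
    (lo hi : ℕ) (hlo : h + 1 ≤ lo) (hhi : hi < n) (b : ℕ) (hb : 1 ≤ b) :
    ((Finset.Icc lo hi).filter fun a =>
        (∀ q, q < h → vg (b + (h - 1 - q)) = ((vg (a - h + q)).1, !(vg (a - h + q)).2)) ∧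
        vg (a - h - 1) ≠ ((vg (b + h)).1, !(vg (b + h)).2) ∧
        vg a ≠ ((vg (b - 1)).1, !(vg (b - 1)).2)).card =
      ∑ x ∈ Finset.univ.filter fun x : Fin k × Bool =>
          x ≠ ((vg (b + h)).1, !(vg (b + h)).2) ∧ x ≠ vg (b + h - 1),
        ∑ y ∈ Finset.univ.filter fun y : Fin k × Bool =>
            y ≠ ((vg (b - 1)).1, !(vg (b - 1)).2) ∧ y ≠ vg b,
          ((Finset.Icc lo hi).filter fun a => ∀ j, j < h + 2 → vg (a - h - 1 + j) =
            (if j = 0 then x else if j ≤ h then ((vg (b + h - j)).1, !(vg (b + h - j)).2)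
              else y)).card := by
  classical
  set X := Finset.univ.filter fun x : Fin k × Bool =>
    x ≠ ((vg (b + h)).1, !(vg (b + h)).2) ∧ x ≠ vg (b + h - 1) with hX
  set Y := Finset.univ.filter fun y : Fin k × Bool =>
    y ≠ ((vg (b - 1)).1, !(vg (b - 1)).2) ∧ y ≠ vg b with hY
  let ρ : Fin k × Bool → Fin k × Bool → ℕ → Fin k × Bool := fun x y j =>
    if j = 0 then x else if j ≤ h then ((vg (b + h - j)).1, !(vg (b + h - j)).2) else y
  set S : Fin k × Bool → Fin k × Bool → Finset ℕ := fun x y =>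
    (Finset.Icc lo hi).filter fun a => ∀ j, j < h + 2 → vg (a - h - 1 + j) = ρ x y j with hS
  show _ = ∑ x ∈ X, ∑ y ∈ Y, (S x y).card
  have hS0 : ∀ x y a, a ∈ S x y → vg (a - h - 1) = x := by
    intro x y a ha
    rw [hS, Finset.mem_filter] at ha
    have e := ha.2 0 (by omega)
    simp only [ρ, if_pos rfl, add_zero] at e
    exact e
  have hS1 : ∀ x y a, a ∈ S x y → vg a = y := by
    intro x y a ha
    rw [hS, Finset.mem_filter, Finset.mem_Icc] at ha
    have e := ha.2 (h + 1) (by omega)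
    simp only [ρ] at e
    rw [if_neg (by omega), if_neg (by omega)] at e
    have e1 : a - h - 1 + (h + 1) = a := by omega
    rw [e1] at e
    exact e
  have hunion : ((Finset.Icc lo hi).filter fun a =>
      (∀ q, q < h → vg (b + (h - 1 - q)) = ((vg (a - h + q)).1, !(vg (a - h + q)).2)) ∧
      vg (a - h - 1) ≠ ((vg (b + h)).1, !(vg (b + h)).2) ∧
      vg a ≠ ((vg (b - 1)).1, !(vg (b - 1)).2)) =
      X.biUnion fun x => Y.biUnion fun y => S x y := by
    ext a
    rw [Finset.mem_filter, Finset.mem_biUnion]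
    constructor
    · rintro ⟨haI, hW, hR, hG⟩
      rw [Finset.mem_Icc] at haI
      obtain ⟨hwin, hx, hy⟩ := (goodA_iff_window vg h hh a b (by omega) hb (vg (a - h - 1))
        (vg a)).mp ⟨hW, hR, hG, rfl, rfl⟩
      refine ⟨vg (a - h - 1), ?_, ?_⟩
      · rw [hX, Finset.mem_filter]
        refine ⟨Finset.mem_univ _, hx, ?_⟩
        have e := hwin 1 (by omega)
        dsimp only at e
        rw [if_neg (by omega), if_pos (by omega)] at e
        have hr := hred (a - h - 1) (by omega)
        have e1 : a - h - 1 + 1 = a - h := by omega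
        rw [e1] at hr e
        intro heq
        apply hr
        rw [e, heq]
      · rw [Finset.mem_biUnion]
        refine ⟨vg a, ?_, ?_⟩
        · rw [hY, Finset.mem_filter]
          refine ⟨Finset.mem_univ _, hy, ?_⟩
          have e := hwin h (by omega)
          dsimp only at e
          rw [if_neg (by omega), if_pos le_rfl] at e
          have hr := hred (a - 1) (by omega)
          have e1 : a - 1 + 1 = a := by omega
          have e2 : a - h - 1 + h = a - 1 := by omega
          have e3 : b + h - h = b := by omega
          rw [e1] at hr
          rw [e2, e3] at e
          intro heq
          apply hr
          rw [e, heq]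
          obtain ⟨u, w⟩ := vg b
          simp
        · rw [hS, Finset.mem_filter, Finset.mem_Icc]
          exact ⟨haI, hwin⟩
    · rintro ⟨x, hx, ha⟩
      rw [Finset.mem_biUnion] at ha
      obtain ⟨y, hy, ha⟩ := ha
      rw [hS, Finset.mem_filter] at ha
      obtain ⟨haI, hwin⟩ := ha
      rw [hX, Finset.mem_filter] at hx
      rw [hY, Finset.mem_filter] at hy
      rw [Finset.mem_Icc] at haI
      obtain ⟨hW, hR, hG, -, -⟩ := (goodA_iff_window vg h hh a b (by omega) hb x y).mpr
        ⟨hwin, hx.2.1, hy.2.1⟩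
      exact ⟨Finset.mem_Icc.mpr haI, hW, hR, hG⟩
  rw [hunion, Finset.card_biUnion]
  · refine Finset.sum_congr rfl fun x _ => ?_
    rw [Finset.card_biUnion]
    intro y _ y' _ hne
    show Disjoint (S x y) (S x y')
    rw [Finset.disjoint_left]
    intro a ha ha'
    exact hne ((hS1 x y a ha).symm.trans (hS1 x y' a ha'))
  · intro x _ x' _ hne
    show Disjoint (Y.biUnion fun y => S x y) (Y.biUnion fun y => S x' y)
    rw [Finset.disjoint_left]
    intro a ha ha'
    rw [Finset.mem_biUnion] at ha ha'
    obtain ⟨y, -, ha⟩ := ha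
    obtain ⟨y', -, ha'⟩ := ha'
    exact hne ((hS0 x y a ha).symm.trans (hS0 x' y' a ha'))

/-- The `(h+2)`-patterns with outgoing start `b` are reduced words.
[cite: CalegariWalker2013, §4.2] -/
theorem goodAPattern_reduced {k : ℕ} (vg : ℕ → Fin k × Bool) (n h : ℕ) (hh : 1 ≤ h)
    (hred : ∀ i, i + 1 < n → vg (i + 1) ≠ ((vg i).1, !(vg i).2))
    (b : ℕ) (hb : 1 ≤ b) (hbn : b + h < n)
    (x y : Fin k × Bool) (hx : x ≠ vg (b + h - 1)) (hy : y ≠ vg b) :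
    let ρ : ℕ → Fin k × Bool := fun j => if j = 0 then x
      else if j ≤ h then ((vg (b + h - j)).1, !(vg (b + h - j)).2) else y
    ∀ j, j + 1 < h + 2 → ρ (j + 1) ≠ ((ρ j).1, !(ρ j).2) := by
  intro ρ j hj
  simp only [ρ]
  rw [if_neg (show j + 1 ≠ 0 by omega)]
  rcases Nat.eq_zero_or_pos j with h0 | h0
  · subst h0
    rw [if_pos (show 0 + 1 ≤ h by omega), if_pos rfl]
    have e : b + h - (0 + 1) = b + h - 1 := by omega
    rw [e, Ne, eq_inv_letter_comm]
    intro heq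
    apply hx
    rw [heq]
    obtain ⟨u, w⟩ := vg (b + h - 1)
    simp
  rw [if_neg (show j ≠ 0 by omega)]
  rcases Nat.lt_or_ge (j + 1) (h + 1) with h1 | h1
  · rw [if_pos (show j + 1 ≤ h by omega), if_pos (show j ≤ h by omega)]
    simp only [Bool.not_not, Prod.mk.eta]
    have hr := hred (b + h - (j + 1)) (by omega)
    have e : b + h - (j + 1) + 1 = b + h - j := by omega
    rw [e] at hr
    intro heq
    exact hr heq.symm
  · have e : j = h := by omega
    subst e
    rw [if_neg (show ¬ j + 1 ≤ j by omega), if_pos le_rfl]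
    simp only [Bool.not_not, Prod.mk.eta]
    have e : b + j - j = b := by omega
    rw [e]
    exact hy

/-- The admissible letters after the corner of a site with outgoing start `b` number
`2k − 2`. [folklore] -/
theorem card_admissibleA_snd {k : ℕ} (vg : ℕ → Fin k × Bool) (n : ℕ)
    (hred : ∀ i, i + 1 < n → vg (i + 1) ≠ ((vg i).1, !(vg i).2)) (b : ℕ) (hb : 1 ≤ b)
    (hbn : b < n) :
    (Finset.univ.filter fun y : Fin k × Bool =>
        y ≠ ((vg (b - 1)).1, !(vg (b - 1)).2) ∧ y ≠ vg b).card = 2 * k - 2 := by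
  apply card_letters_ne_ne
  intro heq
  have hr := hred (b - 1) (by omega)
  have e : b - 1 + 1 = b := by omega
  rw [e] at hr
  exact hr heq.symm

/-! ### Numerical bounds from uniform bounds on the pattern counts -/

/-- **Free corners over a compatible site: two-sided bound.** If every reduced `(2h+2)`-pattern
occurs between `Amin` and `Amax` times (at the positions `c − h − 1`, `c ∈ [lo, hi]`), then a
compatible site has between `(2k−2)² Amin` and `(2k−2)² Amax` free corners.
[cite: CalegariWalker2013, Lemma 4.7] -/
theorem card_patSet_bounds {k : ℕ} (vg : ℕ → Fin k × Bool) (n h : ℕ) (hh : 1 ≤ h)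
    (hred : ∀ i, i + 1 < n → vg (i + 1) ≠ ((vg i).1, !(vg i).2))
    (lo hi : ℕ) (hlo : h + 1 ≤ lo) (hhi : hi + h < n) (Amin Amax : ℕ)
    (hA : ∀ τ : ℕ → Fin k × Bool, (∀ i, i + 1 < 2 * h + 2 → τ (i + 1) ≠ ((τ i).1, !(τ i).2)) →
      Amin ≤ ((Finset.Icc lo hi).filter fun c =>
        ∀ i, i < 2 * h + 2 → vg (c - h - 1 + i) = τ i).card ∧
      ((Finset.Icc lo hi).filter fun c => ∀ i, i < 2 * h + 2 → vg (c - h - 1 + i) = τ i).card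
        ≤ Amax)
    (a b : ℕ) (ha : 1 ≤ a) (han : a + h < n) (hb : h + 1 ≤ b) (hbn : b < n)
    (hG : vg a ≠ ((vg (b - 1)).1, !(vg (b - 1)).2)) :
    (2 * k - 2) * (2 * k - 2) * Amin ≤ ((Finset.Icc lo hi).filter fun c =>
        (∀ q, q < h → vg (a + (h - 1 - q)) = ((vg (c - h + q)).1, !(vg (c - h + q)).2)) ∧
        (∀ q, q < h → vg (c + (h - 1 - q)) = ((vg (b - h + q)).1, !(vg (b - h + q)).2)) ∧
        vg (c - h - 1) ≠ ((vg (a + h)).1, !(vg (a + h)).2) ∧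
        vg (b - h - 1) ≠ ((vg (c + h)).1, !(vg (c + h)).2)).card ∧
    ((Finset.Icc lo hi).filter fun c =>
        (∀ q, q < h → vg (a + (h - 1 - q)) = ((vg (c - h + q)).1, !(vg (c - h + q)).2)) ∧
        (∀ q, q < h → vg (c + (h - 1 - q)) = ((vg (b - h + q)).1, !(vg (b - h + q)).2)) ∧
        vg (c - h - 1) ≠ ((vg (a + h)).1, !(vg (a + h)).2) ∧
        vg (b - h - 1) ≠ ((vg (c + h)).1, !(vg (c + h)).2)).card ≤
      (2 * k - 2) * (2 * k - 2) * Amax := by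
  classical
  rw [card_patSet_eq_sum vg n h hh hred lo hi hlo hhi a b ha hb]
  have hX := card_admissible_fst vg n h hh hred a han
  have hY := card_admissible_snd vg n h hred b hb (by omega)
  set X := Finset.univ.filter fun x : Fin k × Bool =>
    x ≠ ((vg (a + h)).1, !(vg (a + h)).2) ∧ x ≠ vg (a + h - 1)
  set Y := Finset.univ.filter fun y : Fin k × Bool =>
    y ≠ ((vg (b - h - 1)).1, !(vg (b - h - 1)).2) ∧ y ≠ vg (b - h)
  -- every pattern in the sum is reduced
  have hbd : ∀ x ∈ X, ∀ y ∈ Y,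
      Amin ≤ ((Finset.Icc lo hi).filter fun c => ∀ i, i < 2 * h + 2 → vg (c - h - 1 + i) =
        (if i = 0 then x else if i ≤ h then ((vg (a + h - i)).1, !(vg (a + h - i)).2)
          else if i ≤ 2 * h then ((vg (b + h - i)).1, !(vg (b + h - i)).2) else y)).card ∧
      ((Finset.Icc lo hi).filter fun c => ∀ i, i < 2 * h + 2 → vg (c - h - 1 + i) =
        (if i = 0 then x else if i ≤ h then ((vg (a + h - i)).1, !(vg (a + h - i)).2)
          else if i ≤ 2 * h then ((vg (b + h - i)).1, !(vg (b + h - i)).2) else y)).card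
        ≤ Amax := by
    intro x hx y hy
    rw [Finset.mem_filter] at hx hy
    exact hA _ (sitePattern_reduced vg n h hh hred a b ha han hb hbn hG x y hx.2.2 hy.2.2)
  constructor
  · calc (2 * k - 2) * (2 * k - 2) * Amin = ∑ _x ∈ X, ∑ _y ∈ Y, Amin := by
          rw [Finset.sum_const, Finset.sum_const, smul_eq_mul, smul_eq_mul, hX, hY, mul_assoc]
      _ ≤ _ := Finset.sum_le_sum fun x hx => Finset.sum_le_sum fun y hy => (hbd x hx y hy).1
  · calc _ ≤ ∑ _x ∈ X, ∑ _y ∈ Y, Amax :=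
          Finset.sum_le_sum fun x hx => Finset.sum_le_sum fun y hy => (hbd x hx y hy).2
      _ = (2 * k - 2) * (2 * k - 2) * Amax := by
          rw [Finset.sum_const, Finset.sum_const, smul_eq_mul, smul_eq_mul, hX, hY, mul_assoc]

/-- **Sites with incoming end `a`: two-sided bound** in terms of uniform bounds
`Bmin ≤ #occurrences ≤ Bmax` of the reduced `(h+2)`-patterns at the positions `b − 1`,
`b ∈ [lo, hi]`. [cite: CalegariWalker2013, Lemma 4.7] -/
theorem card_goodB_bounds {k : ℕ} (vg : ℕ → Fin k × Bool) (n h : ℕ) (hh : 1 ≤ h)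
    (hred : ∀ i, i + 1 < n → vg (i + 1) ≠ ((vg i).1, !(vg i).2))
    (lo hi : ℕ) (hlo : 1 ≤ lo) (hhi : hi + h < n) (Bmin Bmax : ℕ)
    (hB : ∀ ρ : ℕ → Fin k × Bool, (∀ j, j + 1 < h + 2 → ρ (j + 1) ≠ ((ρ j).1, !(ρ j).2)) →
      Bmin ≤ ((Finset.Icc lo hi).filter fun b => ∀ j, j < h + 2 → vg (b - 1 + j) = ρ j).card ∧
      ((Finset.Icc lo hi).filter fun b => ∀ j, j < h + 2 → vg (b - 1 + j) = ρ j).card ≤ Bmax)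
    (a : ℕ) (ha : h + 1 ≤ a) (han : a < n) :
    (2 * k - 2) * (2 * k - 2) * Bmin ≤ ((Finset.Icc lo hi).filter fun b =>
        (∀ q, q < h → vg (b + (h - 1 - q)) = ((vg (a - h + q)).1, !(vg (a - h + q)).2)) ∧
        vg (a - h - 1) ≠ ((vg (b + h)).1, !(vg (b + h)).2) ∧
        vg a ≠ ((vg (b - 1)).1, !(vg (b - 1)).2)).card ∧
    ((Finset.Icc lo hi).filter fun b =>
        (∀ q, q < h → vg (b + (h - 1 - q)) = ((vg (a - h + q)).1, !(vg (a - h + q)).2)) ∧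
        vg (a - h - 1) ≠ ((vg (b + h)).1, !(vg (b + h)).2) ∧
        vg a ≠ ((vg (b - 1)).1, !(vg (b - 1)).2)).card ≤ (2 * k - 2) * (2 * k - 2) * Bmax := by
  classical
  rw [card_goodB_eq_sum vg n h hh hred lo hi hlo hhi a (by omega)]
  have hX := card_admissibleB_fst vg n hred a (by omega) han
  have hY := card_admissibleB_snd vg n h hred a ha (by omega)
  set X := Finset.univ.filter fun x : Fin k × Bool => x ≠ ((vg a).1, !(vg a).2) ∧ x ≠ vg (a - 1)
  set Y := Finset.univ.filter fun y : Fin k × Bool =>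
    y ≠ ((vg (a - h - 1)).1, !(vg (a - h - 1)).2) ∧ y ≠ vg (a - h)
  have hbd : ∀ x ∈ X, ∀ y ∈ Y,
      Bmin ≤ ((Finset.Icc lo hi).filter fun b => ∀ j, j < h + 2 → vg (b - 1 + j) =
        (if j = 0 then x else if j ≤ h then ((vg (a - j)).1, !(vg (a - j)).2) else y)).card ∧
      ((Finset.Icc lo hi).filter fun b => ∀ j, j < h + 2 → vg (b - 1 + j) =
        (if j = 0 then x else if j ≤ h then ((vg (a - j)).1, !(vg (a - j)).2) else y)).card
        ≤ Bmax := by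
    intro x hx y hy
    rw [Finset.mem_filter] at hx hy
    exact hB _ (goodBPattern_reduced vg n h hh hred a ha han x y hx.2.2 hy.2.2)
  constructor
  · calc (2 * k - 2) * (2 * k - 2) * Bmin = ∑ _x ∈ X, ∑ _y ∈ Y, Bmin := by
          rw [Finset.sum_const, Finset.sum_const, smul_eq_mul, smul_eq_mul, hX, hY, mul_assoc]
      _ ≤ _ := Finset.sum_le_sum fun x hx => Finset.sum_le_sum fun y hy => (hbd x hx y hy).1
  · calc _ ≤ ∑ _x ∈ X, ∑ _y ∈ Y, Bmax :=
          Finset.sum_le_sum fun x hx => Finset.sum_le_sum fun y hy => (hbd x hx y hy).2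
      _ = (2 * k - 2) * (2 * k - 2) * Bmax := by
          rw [Finset.sum_const, Finset.sum_const, smul_eq_mul, smul_eq_mul, hX, hY, mul_assoc]

/-- **Sites with outgoing start `b`: upper bound** in terms of a uniform upper bound `Bmax` for
the number of occurrences of reduced `(h+2)`-patterns at the positions `a − h − 1`,
`a ∈ [lo, hi]`. [cite: CalegariWalker2013, Lemma 4.7] -/
theorem card_goodA_le {k : ℕ} (vg : ℕ → Fin k × Bool) (n h : ℕ) (hh : 1 ≤ h)
    (hred : ∀ i, i + 1 < n → vg (i + 1) ≠ ((vg i).1, !(vg i).2))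
    (lo hi : ℕ) (hlo : h + 1 ≤ lo) (hhi : hi < n) (Bmax : ℕ)
    (hB : ∀ ρ : ℕ → Fin k × Bool, (∀ j, j + 1 < h + 2 → ρ (j + 1) ≠ ((ρ j).1, !(ρ j).2)) →
      ((Finset.Icc lo hi).filter fun a => ∀ j, j < h + 2 → vg (a - h - 1 + j) = ρ j).card
        ≤ Bmax)
    (b : ℕ) (hb : 1 ≤ b) (hbn : b + h < n) :
    ((Finset.Icc lo hi).filter fun a =>
        (∀ q, q < h → vg (b + (h - 1 - q)) = ((vg (a - h + q)).1, !(vg (a - h + q)).2)) ∧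
        vg (a - h - 1) ≠ ((vg (b + h)).1, !(vg (b + h)).2) ∧
        vg a ≠ ((vg (b - 1)).1, !(vg (b - 1)).2)).card ≤ (2 * k - 2) * (2 * k - 2) * Bmax := by
  classical
  rw [card_goodA_eq_sum vg n h hh hred lo hi hlo hhi b hb]
  have hX := card_admissible_fst vg n h hh hred b hbn
  have hY := card_admissibleA_snd vg n hred b hb (by omega)
  set X := Finset.univ.filter fun x : Fin k × Bool =>
    x ≠ ((vg (b + h)).1, !(vg (b + h)).2) ∧ x ≠ vg (b + h - 1)
  set Y := Finset.univ.filter fun y : Fin k × Bool => y ≠ ((vg (b - 1)).1, !(vg (b - 1)).2) ∧ y ≠ vg b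
  have hbd : ∀ x ∈ X, ∀ y ∈ Y,
      ((Finset.Icc lo hi).filter fun a => ∀ j, j < h + 2 → vg (a - h - 1 + j) =
        (if j = 0 then x else if j ≤ h then ((vg (b + h - j)).1, !(vg (b + h - j)).2)
          else y)).card ≤ Bmax := by
    intro x hx y hy
    rw [Finset.mem_filter] at hx hy
    exact hB _ (goodAPattern_reduced vg n h hh hred b hb hbn x y hx.2.2 hy.2.2)
  calc _ ≤ ∑ _x ∈ X, ∑ _y ∈ Y, Bmax :=
        Finset.sum_le_sum fun x hx => Finset.sum_le_sum fun y hy => hbd x hx y hy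
    _ = (2 * k - 2) * (2 * k - 2) * Bmax := by
        rw [Finset.sum_const, Finset.sum_const, smul_eq_mul, smul_eq_mul, hX, hY, mul_assoc]

end TripodPatterns

end Literature.GroupTheory.CombinatorialGroupTheory
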